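import Literature.Barriers.AtomisticToContinuum.HardDiskDeformationCells
import HarnessLib

/-!
# Lemma 18 of Richthammer 2007 in coordinates: the deformed tuple of a source cell lies in the
# target cell of the same order

Sequel to `HardDiskDeformationCells.lean` (provefact `Richthammer2007_ineq35`; the part
"`shearMap (t_c) x ∈ Ã_c`" of the transfer fields of `ShearCells.Admissible`). Richthammer's
Lemma 18 [Richthammer2007, §6.5, p. 14]: for `1 ≤ k ≤ m` and every
`x̃ ∈ X̃_{Λ_n} ∖ {p̃¹, …, p̃^{k-1}}`, `t^k ∘ (T^k)⁻¹(p̃^k) ≤ t^k ∘ (T^k)⁻¹(x̃)`, with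
`(T^k)⁻¹(p̃^k) ≤ (T^k)⁻¹(x̃)` (lexicographically) in case of equality — proved from the
monotonicities `τ^k ≤ τ^l` (5.3''), `t^{k+1} ∘ (T^{k+1})⁻¹ ≤ t^k ∘ (T^k)⁻¹` (6.13) and the identity
(6.12). Consequently the inverse recursion run on `T_π(x)` selects the particles in the order
`π` ((6.26), `x ∈ A_π ⇒ T_π(x) ∈ Ã_π`, the direction "⇒" of (6.22)). Proved here, for both
deformation directions `σ = ±1`:

* `coe_stageShift`, `stageShift_append_le`, `stageFun_antitone` — `t^{k+1} ≤ t^k`;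
* `min_le_stageFun_succ`, `tau_monotone` — (5.3''): `τ¹ ≤ τ² ≤ …` on the source cell;
* `lineRoot_mono` — (6.13) in the form: `f ≤ g ⇒ lineRoot σ f ≤ lineRoot σ g`;
* `injective_shearMap_of_mem_sourceCell` — the deformation does not merge particles;
* **`shearMap_mem_targetCell`** — `x ∈ A_π ⇒ (x_l + σ t_l e₁)_l ∈ Ã^σ_π`.

## References

* [Richthammer2007] T. Richthammer, *Translation-invariance of two-dimensional Gibbsian point
  processes*, Comm. Math. Phys. 274 (2007) 81–122, arXiv:0706.3637: §5.4 (5.3'') (p. 11), §6.3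
  (proof of (5.3''), p. 13), §6.5 Lemma 18, (6.12)–(6.13), (6.26) (pp. 14–16), §6.6 (6.22) (p. 16).
-/

noncomputable section

open MeasureTheory Set Function Filter
open scoped ENNReal NNReal Topology

namespace Literature.Barriers.AtomisticToContinuum.HardDisk

open Literature.Analysis.FunctionSpaces Literature.MeasureTheory.Lebesgue

/-- **(6.13) as monotonicity of the root in the function**: if `f ≤ g` pointwise (both
`L`-Lipschitz along `e₁`, `L < 1`, `|σ| ≤ 1`) then `lineRoot σ f ≤ lineRoot σ g`.
[cite: Richthammer2007, §6.5 (6.13) (p. 15)] -/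
theorem lineRoot_mono {L : ℝ≥0} (hL : L < 1) {f g : EuclideanSpace ℝ (Fin 2) → ℝ}
    (hf : ∀ p, LipschitzWith L fun r : ℝ => f (p + r • EuclideanSpace.single 0 (1 : ℝ)))
    (hg : ∀ p, LipschitzWith L fun r : ℝ => g (p + r • EuclideanSpace.single 0 (1 : ℝ)))
    {σ : ℝ} (hσ : |σ| ≤ 1) (hfg : ∀ y, f y ≤ g y) (z : EuclideanSpace ℝ (Fin 2)) :
    lineRoot σ f z ≤ lineRoot σ g z := by
  rw [le_lineRoot_iff hL hg hσ]
  calc lineRoot σ f z = f (z - (σ * lineRoot σ f z) • EuclideanSpace.single 0 (1 : ℝ)) :=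
        (lineRoot_spec hL hf hσ z).symm
    _ ≤ g (z - (σ * lineRoot σ f z) • EuclideanSpace.single 0 (1 : ℝ)) := hfg _

namespace DeformData

variable {P : DeformData}

/-! ### `t^{k+1} ≤ t^k` -/

/-- The `EReal` infimum defining `t^k` is the real number `stageShift` (nonnegative earlier
`τⁱ`). [cite: Richthammer2007, §5.4 (p. 11)] -/
theorem coe_stageShift (hτ : 0 ≤ P.τ) (hRn : P.R < P.n) (Y : PointConfig (EuclideanSpace ℝ (Fin 2)))
    {E : List (EuclideanSpace ℝ (Fin 2) × ℝ)} (hE : ∀ pt ∈ E, 0 ≤ pt.2) (y : EuclideanSpace ℝ (Fin 2)) :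
    (P.stageShift Y E y : EReal) = (P.baseShift y : EReal) ⊓ P.outShift Y y ⊓ P.listShift E y := by
  set v : EReal := (P.baseShift y : EReal) ⊓ P.outShift Y y ⊓ P.listShift E y with hv
  have hv0 : (0 : EReal) ≤ v :=
    le_inf (le_inf (by exact_mod_cast (baseShift_mem_Icc hτ hRn y).1) (P.outShift_nonneg Y y))
      (P.listShift_nonneg hE y)
  have hv1 : v ≤ (P.baseShift y : EReal) := inf_le_left.trans inf_le_left
  have hvtop : v ≠ ⊤ := ne_top_of_le_ne_top (EReal.coe_ne_top _) hv1
  have hvbot : v ≠ ⊥ := ne_bot_of_le_ne_bot (EReal.coe_ne_bot 0) hv0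
  rw [stageShift, ← hv, EReal.coe_toReal hvtop hvbot]

variable (P) in
/-- Appending a pair adds its constraint: `⋀_{E ++ [pt]} = ⋀_E ⊓ m_{pt}`. [folklore] -/
theorem listShift_append_singleton (E : List (EuclideanSpace ℝ (Fin 2) × ℝ))
    (pt : EuclideanSpace ℝ (Fin 2) × ℝ) (y : EuclideanSpace ℝ (Fin 2)) :
    P.listShift (E ++ [pt]) y = P.listShift E y ⊓ P.mAux pt.1 pt.2 y := by
  induction E with
  | nil => simp [listShift]
  | cons a l ih =>
    simp only [listShift, List.cons_append, List.map_cons, List.foldr_cons] at ih ⊢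
    rw [ih, inf_assoc]

/-- **`t^{k+1} = t^k ∧ m_{p^k,τ^k}`** at the level of values: `↑t^{k+1}(y) = ↑t^k(y) ⊓ m_{pt}(y)`.
[cite: Richthammer2007, §5.4 (p. 11)] -/
theorem coe_stageShift_append (hτ : 0 ≤ P.τ) (hRn : P.R < P.n) (Y : PointConfig (EuclideanSpace ℝ (Fin 2)))
    {E : List (EuclideanSpace ℝ (Fin 2) × ℝ)} (hE : ∀ pt ∈ E, 0 ≤ pt.2)
    {pt : EuclideanSpace ℝ (Fin 2) × ℝ} (hpt : 0 ≤ pt.2) (y : EuclideanSpace ℝ (Fin 2)) :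
    (P.stageShift Y (E ++ [pt]) y : EReal) = (P.stageShift Y E y : EReal) ⊓ P.mAux pt.1 pt.2 y := by
  have hE' : ∀ pt' ∈ E ++ [pt], 0 ≤ pt'.2 := by
    intro pt' h
    rw [List.mem_append, List.mem_singleton] at h
    rcases h with h | rfl
    · exact hE pt' h
    · exact hpt
  rw [coe_stageShift hτ hRn Y hE' y, coe_stageShift hτ hRn Y hE y, listShift_append_singleton]
  simp only [inf_assoc]

/-- `t^{k+1} ≤ t^k`. [cite: Richthammer2007, §6.5 (p. 15, "since `t^{k+1} ≤ t^k`")] -/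
theorem stageShift_append_le (hτ : 0 ≤ P.τ) (hRn : P.R < P.n) (Y : PointConfig (EuclideanSpace ℝ (Fin 2)))
    {E : List (EuclideanSpace ℝ (Fin 2) × ℝ)} (hE : ∀ pt ∈ E, 0 ≤ pt.2)
    {pt : EuclideanSpace ℝ (Fin 2) × ℝ} (hpt : 0 ≤ pt.2) (y : EuclideanSpace ℝ (Fin 2)) :
    P.stageShift Y (E ++ [pt]) y ≤ P.stageShift Y E y := by
  have h := coe_stageShift_append hτ hRn Y hE hpt y
  have : (P.stageShift Y (E ++ [pt]) y : EReal) ≤ (P.stageShift Y E y : EReal) := by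
    rw [h]; exact inf_le_left
  exact EReal.coe_le_coe_iff.1 this

/-- `t^{k+1}(y) ≥ t^k(y) ∧ τ^k` (from `m_{p,τ} ≥ τ`). [cite: Richthammer2007, §6.3 (p. 13, proof of (5.3''))] -/
theorem min_le_stageShift_append (hτ : 0 ≤ P.τ) (hRn : P.R < P.n) (Y : PointConfig (EuclideanSpace ℝ (Fin 2)))
    {E : List (EuclideanSpace ℝ (Fin 2) × ℝ)} (hE : ∀ pt ∈ E, 0 ≤ pt.2)
    {pt : EuclideanSpace ℝ (Fin 2) × ℝ} (hpt : 0 ≤ pt.2) (y : EuclideanSpace ℝ (Fin 2)) :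
    min (P.stageShift Y E y) pt.2 ≤ P.stageShift Y (E ++ [pt]) y := by
  have h := coe_stageShift_append hτ hRn Y hE hpt y
  have : ((min (P.stageShift Y E y) pt.2 : ℝ) : EReal) ≤ (P.stageShift Y (E ++ [pt]) y : EReal) := by
    rw [h, EReal.coe_strictMono.monotone.map_min]
    exact inf_le_inf le_rfl (P.le_mAux pt.1 pt.2 y)
  exact EReal.coe_le_coe_iff.1 this

/-- The stage functions decrease with the stage: `t^{s'+1} ≤ t^{s+1}` for `s ≤ s'`.
[cite: Richthammer2007, §6.5 (6.13) (p. 15)] -/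
theorem stageFun_antitone (hτ : 0 ≤ P.τ) (hRn : P.R < P.n) (Y : PointConfig (EuclideanSpace ℝ (Fin 2)))
    {k : ℕ} (π : Equiv.Perm (Fin k)) (x : Fin k → EuclideanSpace ℝ (Fin 2)) {s s' : ℕ} (hss' : s ≤ s')
    (y : EuclideanSpace ℝ (Fin 2)) : P.stageFun Y π x s' y ≤ P.stageFun Y π x s y := by
  induction hss' with
  | refl => exact le_rfl
  | step h ih =>
    refine le_trans ?_ ih
    unfold stageFun
    rw [stagePairs]
    exact stageShift_append_le hτ hRn Y (stagePairs_nonneg hτ hRn Y _ _)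
      (stageShift_mem_Icc hτ hRn Y (stagePairs_nonneg hτ hRn Y _ _) _).1 y

/-! ### (5.3''): the selected values increase on the source cell -/

/-- The translation of the particle of stage `s` is `τ_s = t^{s+1}(p_s)`. [cite: Richthammer2007, §5.4 (p. 11)] -/
theorem richtShift_rev (Y : PointConfig (EuclideanSpace ℝ (Fin 2))) (k : ℕ) (π : Equiv.Perm (Fin k))
    (x : Fin k → EuclideanSpace ℝ (Fin 2)) (s : Fin k) :
    P.richtShift Y k π (π (Fin.rev s)) x = P.stageFun Y π x s (x (π (Fin.rev s))) := by
  rw [richtShift_eq_stageFun, stageOf_apply, Fin.rev_rev]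

/-- **(5.3'') on the source cell**: `τ_s ≤ τ_{s+1}`. [cite: Richthammer2007, §5.4 (5.3'') and §6.3 (p. 13)] -/
theorem tau_le_tau_succ (hτ : 0 ≤ P.τ) (hRn : P.R < P.n) (Y : PointConfig (EuclideanSpace ℝ (Fin 2)))
    {k : ℕ} {π : Equiv.Perm (Fin k)} {x : Fin k → EuclideanSpace ℝ (Fin 2)}
    (hx : x ∈ P.sourceCell Y k π) (s : ℕ) (hs : s + 1 < k) :
    P.stageFun Y π x s (x (π (Fin.rev ⟨s, Nat.lt_of_succ_lt hs⟩))) ≤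
      P.stageFun Y π x (s + 1) (x (π (Fin.rev ⟨s + 1, hs⟩))) := by
  have hsk : s < k := Nat.lt_of_succ_lt hs
  -- the particle of stage `s+1` is a candidate at stage `s`
  have hcand : π (Fin.rev ⟨s + 1, hs⟩) ∈ remaining π s := by
    simp [remaining, stageOf_apply]
  have hmin : P.stageFun Y π x s (x (π (Fin.rev ⟨s, hsk⟩))) ≤
      P.stageFun Y π x s (x (π (Fin.rev ⟨s + 1, hs⟩))) := (hx.2 ⟨s, hsk⟩).le hcand
  -- `t^{s+2} = t^{s+1} ∧ m_{p_s, τ_s}` and `m ≥ τ_s`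
  have hstep : min (P.stageFun Y π x s (x (π (Fin.rev ⟨s + 1, hs⟩))))
      (P.stageFun Y π x s (x (π (Fin.rev ⟨s, hsk⟩)))) ≤
      P.stageFun Y π x (s + 1) (x (π (Fin.rev ⟨s + 1, hs⟩))) := by
    have hp : posSeq π x s = x (π (Fin.rev ⟨s, hsk⟩)) := by simp [posSeq, dif_pos hsk]
    have h := min_le_stageShift_append hτ hRn Y (stagePairs_nonneg hτ hRn Y (posSeq π x) s)
      (pt := (x (π (Fin.rev ⟨s, hsk⟩)),
        P.stageShift Y (P.stagePairs Y (posSeq π x) s) (x (π (Fin.rev ⟨s, hsk⟩)))))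
      (stageShift_mem_Icc hτ hRn Y (stagePairs_nonneg hτ hRn Y _ _) _).1
      (x (π (Fin.rev ⟨s + 1, hs⟩)))
    unfold stageFun
    rw [stagePairs, hp]
    exact h
  calc P.stageFun Y π x s (x (π (Fin.rev ⟨s, hsk⟩)))
      = min (P.stageFun Y π x s (x (π (Fin.rev ⟨s + 1, hs⟩))))
          (P.stageFun Y π x s (x (π (Fin.rev ⟨s, hsk⟩)))) := (min_eq_right hmin).symm
    _ ≤ _ := hstep

/-- **(5.3''): `τ_s ≤ τ_{s'}` for `s ≤ s'` on the source cell.** [cite: Richthammer2007, §5.4 (5.3'') (p. 11)] -/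
theorem tau_monotone (hτ : 0 ≤ P.τ) (hRn : P.R < P.n) (Y : PointConfig (EuclideanSpace ℝ (Fin 2)))
    {k : ℕ} {π : Equiv.Perm (Fin k)} {x : Fin k → EuclideanSpace ℝ (Fin 2)}
    (hx : x ∈ P.sourceCell Y k π) {s s' : ℕ} (hss' : s ≤ s') (hs' : s' < k) :
    P.stageFun Y π x s (x (π (Fin.rev ⟨s, lt_of_le_of_lt hss' hs'⟩))) ≤
      P.stageFun Y π x s' (x (π (Fin.rev ⟨s', hs'⟩))) := by
  induction hss' with
  | refl => exact le_rfl
  | @step m h ih =>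
    exact (ih (Nat.lt_of_succ_lt hs')).trans (tau_le_tau_succ hτ hRn Y hx m hs')

/-! ### The transfer into the target cell -/

/-- The stage of every particle is `< k`. [folklore] -/
theorem stageOf_lt {k : ℕ} (π : Equiv.Perm (Fin k)) (l : Fin k) : stageOf π l < k :=
  (Fin.rev (π.symm l)).isLt

/-- Every particle is the particle of its stage. [folklore] -/
theorem eq_rev_stageOf {k : ℕ} (π : Equiv.Perm (Fin k)) (l : Fin k) :
    l = π (Fin.rev ⟨stageOf π l, stageOf_lt π l⟩) := by
  have : (⟨stageOf π l, stageOf_lt π l⟩ : Fin k) = Fin.rev (π.symm l) := Fin.ext rfl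
  rw [this, Fin.rev_rev, Equiv.apply_symm_apply]

/-- **The deformation does not merge particles of a source cell** (so the deformed tuple is
injective; cf. Lemma 21, `T̃_n ∘ T_n = id`): two particles with the same image would lie on
one `e₁`-line, and the strict monotonicity of `c ↦ t^{s+1}(w - σ c e₁) - c` together with
`t^{s'+1} ≤ t^{s+1}` and `τ_s ≤ τ_{s'}` forces them to coincide.
[cite: Richthammer2007, §6.5 Lemma 21 (p. 16)] -/
theorem injective_shearMap_of_mem_sourceCell (hε : 0 < P.ε) (hτ : 0 ≤ P.τ) (hτ2 : P.τ ≤ 1 / 2)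
    (hRn : P.R + 1 ≤ P.n) {σ : ℝ} (hσ : |σ| ≤ 1) (Y : PointConfig (EuclideanSpace ℝ (Fin 2)))
    {k : ℕ} {π : Equiv.Perm (Fin k)} {x : Fin k → EuclideanSpace ℝ (Fin 2)}
    (hx : x ∈ P.sourceCell Y k π) :
    Function.Injective (shearMap (fun j y => σ * P.richtShift Y k π j y) x) := by
  have hRn0 : P.R < P.n := Nat.lt_of_succ_le hRn
  have hhalf : (1 / 2 : ℝ≥0) < 1 := by norm_num
  have hlip : ∀ s p, LipschitzWith (1 / 2 : ℝ≥0) fun r : ℝ =>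
      P.stageFun Y π x s (p + r • EuclideanSpace.single 0 (1 : ℝ)) :=
    fun s p => lipschitz_stageShift_line hε hτ hτ2 hRn Y (stagePairs_nonneg hτ hRn0 Y _ _) p
  -- it suffices to treat particles ordered by stage
  suffices key : ∀ l l' : Fin k, stageOf π l ≤ stageOf π l' →
      shearMap (fun j y => σ * P.richtShift Y k π j y) x l =
        shearMap (fun j y => σ * P.richtShift Y k π j y) x l' → l = l' by
    intro l l' h
    rcases le_total (stageOf π l) (stageOf π l') with hle | hle
    · exact key l l' hle h
    · exact (key l' l hle h.symm).symm
  intro l l' hle h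
  set s := stageOf π l with hs
  set s' := stageOf π l' with hs'
  have hsk : s < k := stageOf_lt π l
  have hs'k : s' < k := stageOf_lt π l'
  have hl : l = π (Fin.rev ⟨s, hsk⟩) := eq_rev_stageOf π l
  have hl' : l' = π (Fin.rev ⟨s', hs'k⟩) := eq_rev_stageOf π l'
  -- the translations are `τ_s`, `τ_{s'}`
  have ht : P.richtShift Y k π l x = P.stageFun Y π x s (x l) := by
    rw [richtShift_eq_stageFun]
  have ht' : P.richtShift Y k π l' x = P.stageFun Y π x s' (x l') := by
    rw [richtShift_eq_stageFun]
  rw [shearMap_smul_richtShift_apply, shearMap_smul_richtShift_apply, ht, ht'] at h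
  -- common image point `w`
  set w := x l + (σ * P.stageFun Y π x s (x l)) • EuclideanSpace.single 0 (1 : ℝ) with hw
  have hxl : x l = w - (σ * P.stageFun Y π x s (x l)) • EuclideanSpace.single 0 (1 : ℝ) := by
    rw [hw, add_sub_cancel_right]
  have hxl' : x l' = w - (σ * P.stageFun Y π x s' (x l')) • EuclideanSpace.single 0 (1 : ℝ) := by
    rw [h, add_sub_cancel_right]
  -- the root of `t^{s+1}` at `w` is `τ_s`; and `τ_{s'} ≤ root` would need `t^{s+1}(x l') ≥ τ_{s'}`
  have hroot : lineRoot σ (P.stageFun Y π x s) w = P.stageFun Y π x s (x l) := by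
    rw [hw]; exact lineRoot_shear hhalf (hlip s) hσ (x l)
  -- `τ_s ≤ τ_{s'}` (5.3'') and `t^{s'+1} ≤ t^{s+1}`
  have hτle : P.stageFun Y π x s (x l) ≤ P.stageFun Y π x s' (x l') := by
    have := tau_monotone hτ hRn0 Y hx hle hs'k
    rw [← hl, ← hl'] at this
    exact this
  have hfle : P.stageFun Y π x s' (x l') ≤ P.stageFun Y π x s (x l') :=
    stageFun_antitone hτ hRn0 Y π x hle (x l')
  -- hence `τ_{s'} ≤ lineRoot σ t^{s+1} w = τ_s`, so `τ_s = τ_{s'}` and `x l = x l'`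
  have hge : P.stageFun Y π x s' (x l') ≤ lineRoot σ (P.stageFun Y π x s) w := by
    rw [le_lineRoot_iff hhalf (hlip s) hσ, ← hxl']
    exact hfle
  rw [hroot] at hge
  have heq : P.stageFun Y π x s (x l) = P.stageFun Y π x s' (x l') := le_antisymm hτle hge
  have hxx : x l = x l' := by rw [hxl, hxl', heq]
  exact hx.1 hxx

/-- **Lemma 18 / (6.26): the deformed tuple of a source cell lies in the target cell of the
same order**: for `x ∈ A_π` and `σ = ±1` (any `|σ| ≤ 1`), `(x_l + σ t_l e₁)_l ∈ Ã^σ_π`. At stage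
`s`, with `t̃^{s+1} = t^{s+1}` (`invStageFun_shearMap`): the value of the selected particle is
`lineRoot σ t^{s+1}(p_s + σ τ_s e₁) = τ_s` ((6.12)), while for a remaining particle `l'` of
stage `s' ≥ s`, `lineRoot σ t^{s+1}(x_{l'} + σ τ_{s'} e₁) ≥ lineRoot σ t^{s'+1}(…) = τ_{s'} ≥ τ_s`
((6.13), (5.3'')); in case of equality all these are equalities, the preimages are the original
positions, and the tie-break of `A_π` decides.
[cite: Richthammer2007, §6.5 Lemma 18 and (6.26) (pp. 14–16)] -/
theorem shearMap_mem_targetCell (hε : 0 < P.ε) (hτ : 0 ≤ P.τ) (hτ2 : P.τ ≤ 1 / 2)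
    (hRn : P.R + 1 ≤ P.n) {σ : ℝ} (hσ : |σ| ≤ 1) (Y : PointConfig (EuclideanSpace ℝ (Fin 2)))
    {k : ℕ} {π : Equiv.Perm (Fin k)} {x : Fin k → EuclideanSpace ℝ (Fin 2)}
    (hx : x ∈ P.sourceCell Y k π) :
    shearMap (fun j y => σ * P.richtShift Y k π j y) x ∈ P.targetCell σ Y k π := by
  have hRn0 : P.R < P.n := Nat.lt_of_succ_le hRn
  have hhalf : (1 / 2 : ℝ≥0) < 1 := by norm_num
  have hlip : ∀ s p, LipschitzWith (1 / 2 : ℝ≥0) fun r : ℝ =>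
      P.stageFun Y π x s (p + r • EuclideanSpace.single 0 (1 : ℝ)) :=
    fun s p => lipschitz_stageShift_line hε hτ hτ2 hRn Y (stagePairs_nonneg hτ hRn0 Y _ _) p
  set z := shearMap (fun j y => σ * P.richtShift Y k π j y) x with hz
  refine ⟨injective_shearMap_of_mem_sourceCell hε hτ hτ2 hRn hσ Y hx, fun s => ?_⟩
  -- the inverse stage function is `t^{s+1}`
  have hfun : P.invStageFun σ Y π z s = P.stageFun Y π x s :=
    invStageFun_shearMap hε hτ hτ2 hRn hσ Y k π x s.isLt.le
  rw [hfun]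
  -- notation for the selected particle and its value
  set l₀ := π (Fin.rev s) with hl₀
  have hzl : ∀ l, z l = x l + (σ * P.stageFun Y π x (stageOf π l) (x l)) •
      EuclideanSpace.single 0 (1 : ℝ) := fun l => by
    rw [hz, shearMap_smul_richtShift_apply, richtShift_eq_stageFun]
  have hst₀ : stageOf π l₀ = s := by rw [hl₀, stageOf_apply, Fin.rev_rev]
  have hroot₀ : lineRoot σ (P.stageFun Y π x s) (z l₀) = P.stageFun Y π x s (x l₀) := by
    rw [hzl l₀, hst₀]; exact lineRoot_shear hhalf (hlip s) hσ (x l₀)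
  have hkey₀ : z l₀ - (σ * lineRoot σ (P.stageFun Y π x s) (z l₀)) • EuclideanSpace.single 0 (1 : ℝ) =
      x l₀ := by
    rw [hroot₀, hzl l₀, hst₀, add_sub_cancel_right]
  refine ⟨rev_mem_remaining π s, fun l' hl' hne => ?_⟩
  -- a remaining particle `l'` of stage `s' ≥ s`
  set s' := stageOf π l' with hs'
  have hs'k : s' < k := stageOf_lt π l'
  have hss' : (s : ℕ) ≤ s' := hl'
  have hl'eq : l' = π (Fin.rev ⟨s', hs'k⟩) := eq_rev_stageOf π l'
  -- `τ_s ≤ τ_{s'}` and `t^{s'+1} ≤ t^{s+1}`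
  have hτle : P.stageFun Y π x s (x l₀) ≤ P.stageFun Y π x s' (x l') := by
    have := tau_monotone hτ hRn0 Y hx hss' hs'k
    rw [← hl'eq] at this
    have e : (⟨(s : ℕ), lt_of_le_of_lt hss' hs'k⟩ : Fin k) = s := Fin.ext rfl
    rw [e, ← hl₀] at this
    exact this
  have hfle : ∀ y, P.stageFun Y π x s' y ≤ P.stageFun Y π x s y :=
    fun y => stageFun_antitone hτ hRn0 Y π x hss' y
  -- the value at `l'`: `lineRoot σ t^{s+1} (z l') ≥ lineRoot σ t^{s'+1} (z l') = τ_{s'}`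
  have hroot' : lineRoot σ (P.stageFun Y π x s') (z l') = P.stageFun Y π x s' (x l') := by
    rw [hzl l']; exact lineRoot_shear hhalf (hlip s') hσ (x l')
  have hval : P.stageFun Y π x s' (x l') ≤ lineRoot σ (P.stageFun Y π x s) (z l') := by
    rw [← hroot']
    exact lineRoot_mono hhalf (hlip s') (hlip s) hσ hfle (z l')
  -- compare
  rcases (hτle.trans hval).lt_or_eq with hlt | heq
  · left
    beta_reduce
    rw [hroot₀]
    exact hlt
  · right
    beta_reduce
    have hv : lineRoot σ (P.stageFun Y π x s) (z l₀) = lineRoot σ (P.stageFun Y π x s) (z l') := by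
      rw [hroot₀, heq]
    refine ⟨hv, ?_⟩
    -- all inequalities are equalities: the root at `z l'` is `τ_{s'} = τ_s`, preimage `x l'`
    have h1 : P.stageFun Y π x s' (x l') = lineRoot σ (P.stageFun Y π x s) (z l') :=
      le_antisymm hval (heq.symm.le.trans hτle)
    have hkey' : z l' - (σ * lineRoot σ (P.stageFun Y π x s) (z l')) • EuclideanSpace.single 0 (1 : ℝ) =
        x l' := by
      rw [← h1, hzl l', add_sub_cancel_right]
    rw [hkey₀, hkey']
    -- the tie-break of the source cell: `t^{s+1}(x l₀) = t^{s+1}(x l')` forces `lexLT`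
    have hxval : P.stageFun Y π x s (x l') = P.stageFun Y π x s (x l₀) := by
      -- `root t^{s+1} (z l') = c` with `c = τ_s` means `t^{s+1}(z l' - σ c e₁) = c`, and
      -- `z l' - σ c e₁ = x l'`
      have hspec := lineRoot_spec hhalf (hlip s) hσ (z l')
      rw [hkey'] at hspec
      rw [hspec, ← hv, hroot₀]
    rcases (hx.2 s).2 l' hl' (by rwa [← hl₀]) with hlt' | ⟨-, hlex⟩
    · exfalso
      beta_reduce at hlt'
      rw [← hl₀, hxval] at hlt'
      exact lt_irrefl _ hlt'
    · rwa [← hl₀] at hlex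

end DeformData

end Literature.Barriers.AtomisticToContinuum.HardDisk

end
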